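import Summits.QuantumFields.BalabanUV.T4Continuum.Support.RegionGaugeResolventSplit
import Summits.QuantumFields.BalabanUV.T4Continuum.Support.DirichletStarRenormBoxTower

/-!
# T⁴ programme, spine node NE2 (U1a), sub-row Δ1 «NE2⁰-Dirichlet» — KING's COMPRESSED INJECTED LAW OF THE FAITHFUL `Δ_a(Ω₀)` ON A BOX
# FROM THE INJECTED LAW OF THE LOCAL OPERATOR AND THE TWO-LEVEL CONVERGENCE OF THE |S| GAUGE COLUMNS (owner item O15-a, file 2)

Row NE2 OWNER (unit `b2b-balaban-t4-ne2-p1`, gen 15), file 2 of O15-a, on file 1 `Support/RegionGaugeResolventSplit` (the split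
`Δ_a(Ω₀) = Δ_loc(Ω₀) − B̂·K̂⁻¹·B̂ᴴ`, the transfer identity `injected_split`, the level-free bounds ‖B̂‖ ≤ √(γ′⁻¹), ‖K̂⁻¹‖ ≤ σ₀⁻²,
‖E·G‖ ≤ γ′⁻¹σ₀⁻²γ⁻¹) and on leaf-06-g6's END `DirichletStarRenormBoxTower.towerLimitRate_star_renorm_box_of_compressed` (p236822: the
renormalised box star tower at rate `θ ∈ [(√L)⁻¹, 1)` MODULO `hinjK` only).

 * §1 PER LEVEL, ANY REGION: **`opNorm_injected_le_of_local`** — with `Δ_a(Ω₀)` `γ`-coercive at both levels and any planting `J` with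
   ‖J‖ ≤ 1: `‖G′J − JG‖ ≤ (1+κ)²·‖G̃′J − JG̃‖ + γ⁻²·(√(γ′⁻¹)σ₀⁻²·‖JᴴB̂′ − B̂‖ + (σ₀⁻²·‖B̂′ − JB̂‖ + √(γ′⁻¹)·‖K̂′⁻¹ − K̂⁻¹‖)·√(γ′⁻¹))`,
   `κ = γ′⁻¹σ₀⁻²γ⁻¹`, `G̃ = Δ_loc(Ω₀)⁻¹` (file 1 `regionDeltaLoc`), `B̂ = regionBh`, `K̂ = KcompR`.
 * §2 ALONG THE STAR TOWER ON A COORDINATE BOX (`2 ≤ L`, `0 < a`, `0 < a′`; γ = γ⋆ from the owner's W1 `sliceCoercive_lev_box`):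
   **`hinjK_of_local`** — `hinjK : ∀ k, ‖G_{k+1}·JpR k − JpR k·G_k‖ ≤ C₁·θ^k` FROM the four displayed leaves at rate `θ`
   (L) `hloc : ∀ k, ‖G̃_{k+1}·JpR k − JpR k·G̃_k‖ ≤ Cl·θ^k` — the injected law of the LOCAL operator (componentwise scalar on boxes:
       Laplacian on `Ω ∪ (Ω − e_ν)` with Neumann rows on the ν-faces, Dirichlet on the others, + line mass; its budgets are energy = coercivity,
       interior W2 = interior Gaffney with constant 1, interior Hessian = corner-free SCALAR H²) — the crew's (P-gaffney) + (P-mass) + (R-loc);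
   (B) `hB : ∀ k, ‖B̂_{k+1} − JpR k·B̂_k‖ ≤ Cb·θ^k` and (Bᵗ) `hBt : ∀ k, ‖(JpR k)ᴴ·B̂_{k+1} − B̂_k‖ ≤ Cbt·θ^k` — two-level convergence of the
       |S| gauge columns (gradients of the scalar box solutions with block-constant sources; the deficient-layer trace of ∂ψ enters (Bᵗ));
   (K) `hK : ∀ k, ‖K̂_{k+1}⁻¹ − K̂_k⁻¹‖ ≤ Ck·θ^k` — two-level convergence of Bałaban's normalised `Q′G′²Q′ᴴ` (scalar; gan24 `injected_le_box`);
   and the END **`towerLimitRate_star_renorm_box_of_local`** = leaf-06-g6's END with `hinjK` DISCHARGED from (L)(B)(Bᵗ)(K).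
   (P-gauge) and the Hessian budgets OF THE NONLOCAL OPERATOR (gen 14's cut, R33/R34) are no longer needed.

HONEST FRAMING (T4-DAG p. 1).  Bookkeeping over landed modules ([folklore]); model level (`U = 1`, ONE region = a coordinate box, ONE averaging
scale, finite torus, linear layer, operator norm); the four leaves are DISPLAYED, not proved; `hinjK` / W3̃ on boxes OPEN; NE2 (U1a) NOT proved;
spine PROVED 0/9 unchanged; NOT [B9] (3.16)/(3.23)–(3.27)/(3.42) as printed; NOT infinite volume / mass gap / Clay.  HONEST DEPENDENCY: continuum
YM on T⁴ ⇐ BetaPertH ∧ nine spine estimates (0/9 proved); BetaPertH ⇐ (D1) ∧ (D4) ∧ CAP+tail; G-an2-4 gates asym, D1 and NE2/3/4.  No `sorry`.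
-/

noncomputable section

open scoped BigOperators ComplexConjugate Matrix Matrix.Norms.L2Operator

namespace Summit.QuantumFields.BalabanUV.T4Continuum.RegionGaugeResolventTower

open Literature.MathematicalPhysics.QuantumFieldTheory.Balaban1983to89.B5Prop11Plancherel (Tor fine)
open Literature.MathematicalPhysics.QuantumFieldTheory.Balaban1983to89.B5Prop11Lower (nsq)
open Literature.MathematicalPhysics.QuantumFieldTheory.Balaban1983to89.B5G183RateUnitTower (lev)
open Summit.QuantumFields.BalabanUV.T4Continuum
open Summit.QuantumFields.BalabanUV.T4Continuum.SubtypeCompression (Coercive isUnit_det_of_coercive opNorm_inv_le_of_coercive)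
open Summit.QuantumFields.BalabanUV.T4Continuum.CovariantAveragingTower (TowerLimitRate)
open Summit.QuantumFields.BalabanUV.T4Continuum.BackgroundResolventTower (Cpert)
open Summit.QuantumFields.BalabanUV.T4Continuum.ScalarAveragedPropagator (gammaPs gammaPs_pos)
open Summit.QuantumFields.BalabanUV.T4Continuum.ScalarAveragedCompression (sigma0 sigma0_pos)
open Summit.QuantumFields.BalabanUV.T4Continuum.RegionScalarCompression (KcompR opNorm_KcompR_inv_le)
open Summit.QuantumFields.BalabanUV.T4Continuum.RegionGaugeFixedVector (starReg regionDeltaA)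
open Summit.QuantumFields.BalabanUV.T4Continuum.DirichletSubregionTowerOf (pidx JpR opNorm_JpR_le)
open Summit.QuantumFields.BalabanUV.T4Continuum.DirichletSubregionRenormTower (AnR)
open Summit.QuantumFields.BalabanUV.T4Continuum.DirichletStarVectorTower (starP gamStar gamStar_pos coercive_regionDeltaA_of_slice)
open Summit.QuantumFields.BalabanUV.T4Continuum.RegionInteriorW2 (CgIbox)
open Summit.QuantumFields.BalabanUV.T4Continuum.RegionSliceCoerciveBoxTower (cW1box cW1box_pos)
open Summit.QuantumFields.BalabanUV.T4Continuum.RegionSliceCoerciveBox (sliceCoercive_lev_box)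
open Summit.QuantumFields.BalabanUV.T4Continuum.DirichletStarRenormBoxTower (towerLimitRate_star_renorm_box_of_compressed)
open Summit.QuantumFields.BalabanUV.T4Continuum.RegionGaugeResolventSplit
open Summit.QuantumFields.BalabanUV.Beta.GAN24.DirichletBoxTwoLevel (IsCoordBox)

variable {d : ℕ}

/-! ## §1 Per level, any region: the faithful injected defect from the local one and the gauge columns -/

section Level

variable (n n' : ℕ) [NeZero n] [NeZero n'] (M : Fin d → ℕ) [hM : ∀ μ, NeZero (M μ)] (a a' : ℝ) (S : Tor M → Prop) [DecidablePred S]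

/-- the level-free gauge constant `κ(γ) = γ′⁻¹·σ₀⁻²·γ⁻¹` (bound on `‖E·G‖`, `‖G·E‖`). [folklore] -/
def kap (d : ℕ) (a' γ : ℝ) : ℝ := (gammaPs d a')⁻¹ * ((sigma0 d a') ^ 2)⁻¹ * γ⁻¹

/-- `0 ≤ κ`. [folklore] -/
theorem kap_nonneg {γ : ℝ} (hγ : 0 < γ) : 0 ≤ kap d a' γ := by
  unfold kap
  exact mul_nonneg (mul_nonneg (inv_nonneg.mpr (gammaPs_pos (d := d) (a' := a')).1.le) (inv_nonneg.mpr (sq_nonneg _)))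
    (inv_nonneg.mpr hγ.le)

/-- the gauge-column part of the two-level constant: `√(γ′⁻¹)σ₀⁻²·εBt + (εB·σ₀⁻² + √(γ′⁻¹)·εK)·√(γ′⁻¹)`. [folklore] -/
def gaugeErr (d : ℕ) (a' εB εBt εK : ℝ) : ℝ :=
  Real.sqrt ((gammaPs d a')⁻¹) * ((sigma0 d a') ^ 2)⁻¹ * εBt
    + (εB * ((sigma0 d a') ^ 2)⁻¹ + Real.sqrt ((gammaPs d a')⁻¹) * εK) * Real.sqrt ((gammaPs d a')⁻¹)

/-- **THE FAITHFUL INJECTED DEFECT FROM THE LOCAL ONE AND THE GAUGE COLUMNS** (any region, two levels `n`, `n′`, any planting `J` with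
‖J‖ ≤ 1, `Δ_a(Ω₀)` `γ`-coercive at both levels, `0 < a′`):
`‖G′J − JG‖ ≤ (1+κ)·εloc·(1+κ) + γ⁻¹·gaugeErr(εB, εBt, εK)·γ⁻¹`. [folklore] -/
theorem opNorm_injected_le_of_local (ha' : 0 < a') {γ : ℝ} (hγ : 0 < γ)
    (hco : Coercive (regionDeltaA n M a a' S) γ) (hco' : Coercive (regionDeltaA n' M a a' S) γ)
    (J : Matrix {b // starReg n' M S b} {b // starReg n M S b} ℂ) (hJ : ‖J‖ ≤ 1) {εloc εB εBt εK : ℝ} (hεB : 0 ≤ εB)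
    (hloc : ‖(regionDeltaLoc n' M a S)⁻¹ * J - J * (regionDeltaLoc n M a S)⁻¹‖ ≤ εloc)
    (hB : ‖regionBh n' M a' S - J * regionBh n M a' S‖ ≤ εB)
    (hBt : ‖Jᴴ * regionBh n' M a' S - regionBh n M a' S‖ ≤ εBt)
    (hK : ‖(KcompR n' M a' S)⁻¹ - (KcompR n M a' S)⁻¹‖ ≤ εK) :
    ‖(regionDeltaA n' M a a' S)⁻¹ * J - J * (regionDeltaA n M a a' S)⁻¹‖
      ≤ (1 + kap d a' γ) * εloc * (1 + kap d a' γ) + γ⁻¹ * gaugeErr d a' εB εBt εK * γ⁻¹ := by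
  have hX := isUnit_det_of_coercive hγ hco
  have hX' := isUnit_det_of_coercive hγ hco'
  have hY := (opNorm_inv_regionDeltaLoc_le n M a a' S ha' hγ hco).1
  have hY' := (opNorm_inv_regionDeltaLoc_le n' M a a' S ha' hγ hco').1
  have hg : ‖(regionDeltaA n M a a' S)⁻¹‖ ≤ γ⁻¹ := opNorm_inv_le_of_coercive hγ hco
  have hg' : ‖(regionDeltaA n' M a a' S)⁻¹‖ ≤ γ⁻¹ := opNorm_inv_le_of_coercive hγ hco'
  have hκ := (opNorm_gaugeE_mul_inv_le n M a a' S ha' hγ hco).1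
  have hκ' := (opNorm_gaugeE_mul_inv_le n' M a a' S ha' hγ hco').2
  have h1 := opNorm_injected_le_split hX hY (regionDeltaA_eq_loc_sub n M a a' S ha') hX' hY' (regionDeltaA_eq_loc_sub n' M a a' S ha')
    J hκ hκ' hg hg' (inv_nonneg.mpr hγ.le)
  have hσ : 0 ≤ ((sigma0 d a') ^ 2)⁻¹ := inv_nonneg.mpr (sq_nonneg _)
  have hγ' : 0 ≤ Real.sqrt ((gammaPs d a')⁻¹) := Real.sqrt_nonneg _
  have h2 := opNorm_sandwich_comm_le (regionBh n M a' S) (regionBh n' M a' S) ((KcompR n M a' S)⁻¹) ((KcompR n' M a' S)⁻¹) J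
    (opNorm_regionBh_le n M a' S ha') (opNorm_regionBh_le n' M a' S ha') (opNorm_KcompR_inv_le n' M a' S ha') hJ hB hBt hK
    hγ' hγ' hσ zero_le_one hεB
  rw [one_mul] at h2
  have hκ0 : 0 ≤ 1 + kap d a' γ := by have := kap_nonneg (d := d) a' hγ; linarith
  calc ‖(regionDeltaA n' M a a' S)⁻¹ * J - J * (regionDeltaA n M a a' S)⁻¹‖
      ≤ (1 + kap d a' γ) * ‖(regionDeltaLoc n' M a S)⁻¹ * J - J * (regionDeltaLoc n M a S)⁻¹‖ * (1 + kap d a' γ)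
          + γ⁻¹ * ‖regionBh n' M a' S * (KcompR n' M a' S)⁻¹ * (regionBh n' M a' S)ᴴ * J
              - J * (regionBh n M a' S * (KcompR n M a' S)⁻¹ * (regionBh n M a' S)ᴴ)‖ * γ⁻¹ := h1
    _ ≤ (1 + kap d a' γ) * εloc * (1 + kap d a' γ) + γ⁻¹ * gaugeErr d a' εB εBt εK * γ⁻¹ := by
          unfold gaugeErr
          gcongr

end Level

/-! ## §2 Along the star tower on a coordinate box: `hinjK` from the four displayed leaves, and the END -/

section Tower

variable (L : ℕ) [NeZero L] (M : Fin d → ℕ) [hM : ∀ μ, NeZero (M μ)] (S : Tor M → Prop) [DecidablePred S] (a a' : ℝ)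

/-- the two-level constant of the faithful tower from the four leaf constants. [folklore] -/
def C1loc (d : ℕ) (a a' Cl Cb Cbt Ck : ℝ) : ℝ :=
  (1 + kap d a' (gamStar d a' (cW1box d a a' 4))) * Cl * (1 + kap d a' (gamStar d a' (cW1box d a a' 4)))
    + (gamStar d a' (cW1box d a a' 4))⁻¹ * gaugeErr d a' Cb Cbt Ck * (gamStar d a' (cW1box d a a' 4))⁻¹

/-- **`hinjK` ON A COORDINATE BOX FROM THE FOUR DISPLAYED LEAVES AT RATE `θ`** (`2 ≤ L`, `0 < a`, `0 < a′`, `0 ≤ θ`): the injected law of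
the LOCAL operator (L), the two-level convergence of the gauge columns (B)/(Bᵗ) and of `K̂⁻¹` (K) ⟹ King's compressed injected law of the
faithful `Δ_a(Ω₀)` with constant `C1loc`. [folklore] -/
theorem hinjK_of_local (hL : 2 ≤ L) (hbox : IsCoordBox M S) (ha : 0 < a) (ha' : 0 < a') {θ Cl Cb Cbt Ck : ℝ} (hθ : 0 ≤ θ)
    (hCb : 0 ≤ Cb)
    (hloc : ∀ k, ‖(regionDeltaLoc (lev L (k + 1)) M a S)⁻¹ * JpR L M (starP L M S) k
        - JpR L M (starP L M S) k * (regionDeltaLoc (lev L k) M a S)⁻¹‖ ≤ Cl * θ ^ k)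
    (hB : ∀ k, ‖regionBh (lev L (k + 1)) M a' S - JpR L M (starP L M S) k * regionBh (lev L k) M a' S‖ ≤ Cb * θ ^ k)
    (hBt : ∀ k, ‖(JpR L M (starP L M S) k)ᴴ * regionBh (lev L (k + 1)) M a' S - regionBh (lev L k) M a' S‖ ≤ Cbt * θ ^ k)
    (hK : ∀ k, ‖(KcompR (lev L (k + 1)) M a' S)⁻¹ - (KcompR (lev L k) M a' S)⁻¹‖ ≤ Ck * θ ^ k) (k : ℕ) :
    ‖(regionDeltaA (lev L (k + 1)) M a a' S)⁻¹ * JpR L M (starP L M S) k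
        - JpR L M (starP L M S) k * (regionDeltaA (lev L k) M a a' S)⁻¹‖ ≤ C1loc d a a' Cl Cb Cbt Ck * θ ^ k := by
  have hc := cW1box_pos (d := d) a a' (Cf := 4) ha ha'
  have hγ : 0 < gamStar d a' (cW1box d a a' 4) := gamStar_pos (d := d) a' hc
  have hco : ∀ j, Coercive (regionDeltaA (lev L j) M a a' S) (gamStar d a' (cW1box d a a' 4)) :=
    fun j => coercive_regionDeltaA_of_slice (lev L j) M a a' S ha' hc (sliceCoercive_lev_box M a a' S L hL hbox ha ha' j)
  have hθk : 0 ≤ θ ^ k := pow_nonneg hθ k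
  have h := opNorm_injected_le_of_local (lev L k) (lev L (k + 1)) M a a' S ha' hγ (hco k) (hco (k + 1))
    (JpR L M (starP L M S) k) (opNorm_JpR_le L M (starP L M S) k) (mul_nonneg hCb hθk) (hloc k) (hB k) (hBt k) (hK k)
  refine h.trans (le_of_eq ?_)
  unfold C1loc gaugeErr
  ring

/-- **THE RENORMALISED STAR TOWER OF THE FAITHFUL `Δ_a(Ω₀)` ON A COORDINATE BOX AT RATE `θ ∈ [(√L)⁻¹, 1)` MODULO THE FOUR LEAVES
(L)(B)(Bᵗ)(K)** — leaf-06-g6's `towerLimitRate_star_renorm_box_of_compressed` with `hinjK` DISCHARGED by `hinjK_of_local`; W1 (the owner's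
`sliceCoercive_lev_box`), interior W2, the class-Poincaré socket, W3̃ ⟺ W3 and the resolvent split are all consumed BY NAME. [folklore] -/
theorem towerLimitRate_star_renorm_box_of_local (hL : 2 ≤ L) (hbox : IsCoordBox M S) (ha : 0 < a) (ha' : 0 < a')
    {θ Cl Cb Cbt Ck : ℝ} (hθ : (Real.sqrt L)⁻¹ ≤ θ) (hθ1 : θ < 1) (hCb : 0 ≤ Cb)
    (hloc : ∀ k, ‖(regionDeltaLoc (lev L (k + 1)) M a S)⁻¹ * JpR L M (starP L M S) k
        - JpR L M (starP L M S) k * (regionDeltaLoc (lev L k) M a S)⁻¹‖ ≤ Cl * θ ^ k)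
    (hB : ∀ k, ‖regionBh (lev L (k + 1)) M a' S - JpR L M (starP L M S) k * regionBh (lev L k) M a' S‖ ≤ Cb * θ ^ k)
    (hBt : ∀ k, ‖(JpR L M (starP L M S) k)ᴴ * regionBh (lev L (k + 1)) M a' S - regionBh (lev L k) M a' S‖ ≤ Cbt * θ ^ k)
    (hK : ∀ k, ‖(KcompR (lev L (k + 1)) M a' S)⁻¹ - (KcompR (lev L k) M a' S)⁻¹‖ ≤ Ck * θ ^ k) :
    TowerLimitRate (AnR L M (starP L M S)) ((L : ℝ) ^ d) (fun k => (regionDeltaA (lev L k) M a a' S)⁻¹)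
      (Cpert 0 (Real.sqrt (CgIbox d a' (cW1box d a a' 4) / 2 * (gamStar d a' (cW1box d a a' 4))⁻¹))
        (Real.sqrt L * C1loc d a a' Cl Cb Cbt Ck + (2 * (Real.sqrt L - 1) * Real.sqrt ((2 * (gamStar d a' (cW1box d a a' 4))⁻¹
          + CgIbox d a' (cW1box d a a' 4)) * (gamStar d a' (cW1box d a a' 4))⁻¹))) 0 0 0) θ :=
  towerLimitRate_star_renorm_box_of_compressed L M S a a' hL hbox ha ha' hθ hθ1
    (hinjK_of_local L M S a a' hL hbox ha ha' (le_trans (inv_nonneg.mpr (Real.sqrt_nonneg _)) hθ) hCb hloc hB hBt hK)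

end Tower

end Summit.QuantumFields.BalabanUV.T4Continuum.RegionGaugeResolventTower

end
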